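import Summits.Ventures.HSemireg.SquareRootCountCRT
import Summits.Ventures.HSemireg.HenselSquareRoots
import Summits.Ventures.HSemireg.SquareRootCountModPrime
import Mathlib.Data.Nat.Factorization.Induction
import Mathlib.Data.Nat.PrimeFin
import Mathlib.Tactic.Simproc.Factors
import HarnessLib

/-!
# Venture HSemireg — THEOREM 35-B's residue count in full: `#{A ∈ ℤ∕d : A² ≡ −2} = 2^{ω(d′)}` for every `d` with `4 ∤ d` all of whose odd
# prime factors are `≡ 1, 3 (mod 8)` (ENGINE-W PROBE5 §35 (3)) — assembled from CRT, Hensel and the second supplement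

HONEST FRAMING. Lean index of the computation cell `pub-hsemireg`, widening group ENGINE-W (code A, seat `engine-w-1`, gen 17).
ELEMENTARY NUMBER THEORY; no abelian variety, sheaf, `Ext` group, secant structure or semiregularity map is constructed; nothing here says
that HC, HC_CM or HC_AV holds. Theorems only (0 `def`, 0 named fact, 0 `sorry`). New namespace `ResidueCount`. IMPORTS three ENGINE-W
kernel files (`SquareRootCountCRT`, `HenselSquareRoots`, `SquareRootCountModPrime`) — this file is CHAINED behind their landing.

SOURCE (the cell's own result): `widen/ENGINE-W/out/probe5/PROBE5-STIZ-A.md` §35 (3) **THEOREM 35-B** as printed: «The residues `A mod d` with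
`A² ≡ −2` number `2^{ω(d′)}` (`d′` = odd part of `d`; `2 ∥ d` at most, `4 ∤ A² + 2`) …». For an admissible determinant every odd prime
`ℓ ∣ d` divides some `A² + 2`, so `−2` is a square mod `ℓ`, i.e. `ℓ ≡ 1, 3 (mod 8)`; under exactly this hypothesis the kernel proves the
count. What the kernel holds:

* §1 transfer lemmas: `natCard_sq_congr` (`ℤ∕m ≃ ℤ∕n` for `m = n` preserves the count), hypotheses descend to coprime factors.
* §2 **`natCard_sqrts_neg_two`** — for `d ≠ 0` with `¬ 4 ∣ d` and every odd prime factor `≡ 1` or `3 (mod 8)`: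
  `Nat.card {x : ℤ∕d // x² = −2} = 2 ^ #{ℓ ∈ primeFactors d : ℓ ≠ 2}` — by `Nat.recOnPosPrimePosCoprime`: prime powers via
  `HenselSqrt.card_sqrt_pow` + `SqrtModPrime.card_sqrts_neg_two` (odd `ℓ`) or the single root mod `2` (`ℓ = 2`, exponent `1`), coprime
  products via `RootCountCRT.card_sq_eq_mul` and `Nat.Coprime.primeFactors_mul`.
* §3 instances recovered from the theorem: `d = 561 ↦ 8`, `d = 99 ↦ 4`, `d = 54 ↦ 2`, `d = 1122 ↦ 8`.
-/

namespace Summit.Ventures.HSemireg.ResidueCount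

open Nat

/-! ## §1 Transfer lemmas -/

/-- Equal moduli give equal counts (transport along `ZMod.ringEquivCongr`). [kernel] -/
theorem natCard_sq_congr {m n : ℕ} (h : m = n) (a : ℤ) :
    Nat.card {x : ZMod m // x ^ 2 = (a : ZMod m)} = Nat.card {x : ZMod n // x ^ 2 = (a : ZMod n)} := by
  subst h; rfl

/-- `ZMod 2`: exactly one root of `x² = −2` (namely `0`). [kernel, `decide`] -/
theorem natCard_two : Nat.card {x : ZMod 2 // x ^ 2 = ((-2 : ℤ) : ZMod 2)} = 1 := by
  rw [Nat.card_eq_fintype_card]; decide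

/-- A prime power `2^n` with `¬ 4 ∣ 2^n` and `0 < n` is `2` itself (`n = 1`). [kernel] -/
theorem two_pow_eq_two {n : ℕ} (hn : 0 < n) (h4 : ¬ 4 ∣ 2 ^ n) : 2 ^ n = 2 := by
  rcases Nat.lt_or_ge n 2 with h | h
  · interval_cases n; rfl
  · exfalso; apply h4
    obtain ⟨k, rfl⟩ := Nat.exists_eq_add_of_le h
    exact ⟨2 ^ k, by rw [pow_add]; norm_num⟩

/-! ## §2 The count -/

/-- **THEOREM 35-B's count**: for `d ≠ 0` with `4 ∤ d` whose odd prime factors are all `≡ 1, 3 (mod 8)`,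
`#{x ∈ ℤ∕d : x² = −2} = 2^{#{ℓ ∈ primeFactors d : ℓ ≠ 2}}` (`= 2^{ω(d′)}`). [kernel] -/
theorem natCard_sqrts_neg_two :
    ∀ d : ℕ, d ≠ 0 → ¬ 4 ∣ d → (∀ ℓ ∈ d.primeFactors, ℓ ≠ 2 → ℓ % 8 = 1 ∨ ℓ % 8 = 3) →
      Nat.card {x : ZMod d // x ^ 2 = ((-2 : ℤ) : ZMod d)} = 2 ^ (d.primeFactors.filter (· ≠ 2)).card := by
  refine Nat.recOnPosPrimePosCoprime ?_ ?_ ?_ ?_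
  · -- prime powers p ^ n, 0 < n
    intro p n hp hn _ h4 hmod
    haveI : Fact p.Prime := ⟨hp⟩
    rw [Nat.primeFactors_prime_pow hn.ne' hp]
    by_cases hp2 : p = 2
    · subst hp2
      rw [natCard_sq_congr (two_pow_eq_two hn h4), natCard_two, Finset.filter_singleton, if_neg (by decide),
        Finset.card_empty, pow_zero]
    · -- odd prime: Hensel down to p, then the second supplement
      have hcount : (({p} : Finset ℕ).filter (· ≠ 2)).card = 1 := by
        rw [Finset.filter_singleton, if_pos hp2, Finset.card_singleton]
      rw [hcount, pow_one, Nat.card_eq_fintype_card,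
        HenselSqrt.card_sqrt_pow p hp2 (-2) (by
          intro h
          have h2 : (p : ℤ) ∣ 2 := by simpa using h
          have := Int.le_of_dvd (by norm_num) h2
          have := hp.two_le
          omega) n hn]
      rw [← Nat.card_eq_fintype_card, natCard_sq_congr (pow_one p), Nat.card_eq_fintype_card]
      have hm := hmod p (by rw [Nat.primeFactors_prime_pow hn.ne' hp]; exact Finset.mem_singleton_self p) hp2
      have := SqrtModPrime.card_sqrts_neg_two p hp2
      rw [if_pos hm] at this
      simpa using this
  · intro h; exact absurd rfl h
  · intro _ _ _
    rw [Nat.primeFactors_one]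
    simpa using RootCountCRT.natCard_sq_one (-2)
  · -- coprime products
    intro a b ha hb hab iha ihb _ h4 hmod
    have ha0 : a ≠ 0 := by omega
    have hb0 : b ≠ 0 := by omega
    haveI : NeZero a := ⟨ha0⟩
    haveI : NeZero b := ⟨hb0⟩
    have h4a : ¬ 4 ∣ a := fun h => h4 (h.trans (Dvd.intro b rfl))
    have h4b : ¬ 4 ∣ b := fun h => h4 (h.trans (Dvd.intro_left a rfl))
    have hmoda : ∀ ℓ ∈ a.primeFactors, ℓ ≠ 2 → ℓ % 8 = 1 ∨ ℓ % 8 = 3 := fun ℓ hℓ =>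
      hmod ℓ (Nat.primeFactors_mono (Dvd.intro b rfl) (mul_ne_zero ha0 hb0) hℓ)
    have hmodb : ∀ ℓ ∈ b.primeFactors, ℓ ≠ 2 → ℓ % 8 = 1 ∨ ℓ % 8 = 3 := fun ℓ hℓ =>
      hmod ℓ (Nat.primeFactors_mono (Dvd.intro_left a rfl) (mul_ne_zero ha0 hb0) hℓ)
    rw [Nat.card_eq_fintype_card, RootCountCRT.card_sq_eq_mul a b hab (-2), ← Nat.card_eq_fintype_card, ← Nat.card_eq_fintype_card,
      iha ha0 h4a hmoda, ihb hb0 h4b hmodb, ← pow_add, hab.primeFactors_mul, Finset.filter_union,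
      Finset.card_union_of_disjoint (Finset.disjoint_filter_filter hab.disjoint_primeFactors)]

/-! ## §3 Instances recovered from the theorem -/

/-- `d = 561 = 3·11·17 ↦ 2³ = 8`; `d = 99 = 9·11 ↦ 4`; `d = 54 = 2·27 ↦ 2`; `d = 1122 = 2·561 ↦ 8` — the census determinants, now by the
general theorem (hypotheses discharged by `decide`). [kernel] -/
theorem instances :
    Nat.card {x : ZMod 561 // x ^ 2 = ((-2 : ℤ) : ZMod 561)} = 8 ∧
    Nat.card {x : ZMod 99 // x ^ 2 = ((-2 : ℤ) : ZMod 99)} = 4 ∧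
    Nat.card {x : ZMod 54 // x ^ 2 = ((-2 : ℤ) : ZMod 54)} = 2 ∧
    Nat.card {x : ZMod 1122 // x ^ 2 = ((-2 : ℤ) : ZMod 1122)} = 8 := by
  have h561 : Nat.primeFactors 561 = {3, 11, 17} := by
    rw [← Nat.toFinset_factors]; simp [Nat.primeFactorsList_ofNat]
  have h99 : Nat.primeFactors 99 = {3, 11} := by
    rw [← Nat.toFinset_factors]; simp [Nat.primeFactorsList_ofNat]
  have h54 : Nat.primeFactors 54 = {2, 3} := by
    rw [← Nat.toFinset_factors]; simp [Nat.primeFactorsList_ofNat]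
  have h1122 : Nat.primeFactors 1122 = {2, 3, 11, 17} := by
    rw [← Nat.toFinset_factors]; simp [Nat.primeFactorsList_ofNat]
  refine ⟨?_, ?_, ?_, ?_⟩
  · rw [natCard_sqrts_neg_two 561 (by norm_num) (by norm_num) (by rw [h561]; decide), h561]; decide
  · rw [natCard_sqrts_neg_two 99 (by norm_num) (by norm_num) (by rw [h99]; decide), h99]; decide
  · rw [natCard_sqrts_neg_two 54 (by norm_num) (by norm_num) (by rw [h54]; decide), h54]; decide
  · rw [natCard_sqrts_neg_two 1122 (by norm_num) (by norm_num) (by rw [h1122]; decide), h1122]; decide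

end Summit.Ventures.HSemireg.ResidueCount
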